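import Literature.Computability.Complexity.ExtMonotoneGates

/-!
# GRANK gates accept exactly the upward closure of the monomial supports of the minors

For the generic-rank threshold gates `IsGRankGate` of `ExtMonotoneGates.lean` (Edmonds 1967;
route PneNP/ConvexRankGates): `θ ≤ rank_{Frac F[X]} (K₀ + ∑_{vᵢ=1} Xᵢ Kᵢ)` holds iff some
`θ × θ` minor of the GENERIC symbolic matrix `K₀ + ∑ᵢ Xᵢ Kᵢ` (`symbolicPolyMatrix`) has a
monomial all of whose variables are switched on in `v` (`le_rank_symbolicMatrix_iff`). Hence a
GRANK gate is the monotone DNF whose terms are the variable-supports of the monomials of the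
`θ`-minors (`IsGRankGate.eq_true_iff_exists_support`): its only freedom beyond a monotone formula
is CANCELLATION between the monomials of a determinant, which can delete terms but never create
non-monotone behaviour. Ingredients: killing the unselected variables acts diagonally on
monomials (`killVars_monomial`, `coeff_killVars`, `killVars_ne_zero_iff`) and rank is witnessed
by a non-zero minor (`Literature.LinearAlgebra.Matrix.le_rank_iff_exists_det_submatrix_ne_zero`).

References: J. Edmonds, *Systems of distinct representatives and linear algebra*, J. Res. NBS
71B (1967), §5 Thm. 1 and §7 [Edmonds1967].
-/

namespace Literature.Computability.Complexity

open MvPolynomial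

section GRankSupport

variable {F : Type*} [Field F] {n d : ℕ}

/-- Killing the unselected variables acts diagonally on monomials: a monomial survives iff all
its variables are selected, and is killed otherwise. [folklore] -/
theorem killVars_monomial (v : Fin n → Bool) (s : Fin n →₀ ℕ) (a : F) :
    killVars v (monomial s a) =
      if ∀ i ∈ s.support, v i = true then monomial s a else 0 := by
  rw [killVars, aeval_monomial]
  split_ifs with h
  · rw [monomial_eq, algebraMap_eq]
    congr 1
    exact Finsupp.prod_congr fun i hi => by rw [if_pos (h i hi)]
  · push Not at h
    obtain ⟨i, hi, hvi⟩ := h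
    rw [Finsupp.prod, Finset.prod_eq_zero hi, mul_zero]
    rw [if_neg hvi, zero_pow (Finsupp.mem_support_iff.1 hi)]

/-- Coefficients after killing: `coeff s (killVars v P) = coeff s P` if all variables of `s` are
selected, `0` otherwise. [folklore] -/
theorem coeff_killVars (v : Fin n → Bool) (P : MvPolynomial (Fin n) F) (s : Fin n →₀ ℕ) :
    (killVars v P).coeff s = if ∀ i ∈ s.support, v i = true then P.coeff s else 0 := by
  conv_lhs => rw [P.as_sum, map_sum]
  simp only [killVars_monomial, coeff_sum]
  rw [Finset.sum_eq_single s]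
  · by_cases hs : s ∈ P.support
    · split_ifs with h <;> simp
    · have h0 : P.coeff s = 0 := by simpa [mem_support_iff] using hs
      split_ifs with h <;> simp [h0]
  · intro t _ hts
    split_ifs with h
    · rw [coeff_monomial, if_neg hts]
    · rfl
  · intro hs
    have h0 : P.coeff s = 0 := by simpa [mem_support_iff] using hs
    split_ifs with h <;> simp [h0]

/-- `killVars v P ≠ 0` iff some monomial of `P` has all its variables selected. [folklore] -/
theorem killVars_ne_zero_iff (v : Fin n → Bool) (P : MvPolynomial (Fin n) F) :
    killVars v P ≠ 0 ↔ ∃ s ∈ P.support, ∀ i ∈ s.support, v i = true := by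
  constructor
  · intro h
    obtain ⟨s, hs⟩ : ∃ s, (killVars v P).coeff s ≠ 0 := by
      by_contra hall
      push Not at hall
      exact h (MvPolynomial.ext _ _ fun s => by rw [hall s, coeff_zero])
    rw [coeff_killVars] at hs
    by_cases hc : ∀ i ∈ s.support, v i = true
    · rw [if_pos hc] at hs
      exact ⟨s, mem_support_iff.2 hs, hc⟩
    · rw [if_neg hc] at hs
      exact absurd rfl hs
  · rintro ⟨s, hs, hc⟩ h0
    have := congrArg (coeff s) h0
    rw [coeff_killVars, if_pos hc, coeff_zero] at this
    exact (mem_support_iff.1 hs) this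

/-- **Generic rank through monomial supports** (Edmonds 1967, §5 Thm. 1: rank = largest
non-vanishing minor; minors commute with `Xᵢ := 0`): `θ ≤ rank (K₀ + ∑_{vᵢ=1} Xᵢ Kᵢ)` over
`Frac F[X]` iff some `θ × θ` minor of the generic symbolic matrix `K₀ + ∑ᵢ Xᵢ Kᵢ` has a monomial
whose variables are all switched on in `v`. [cite: Edmonds1967, §5 Thm. 1 and §7] -/
theorem le_rank_symbolicMatrix_iff (K₀ : Matrix (Fin d) (Fin d) F)
    (K : Fin n → Matrix (Fin d) (Fin d) F) (v : Fin n → Bool) (θ : ℕ) :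
    θ ≤ (symbolicMatrix K₀ K v).rank ↔ ∃ (r c : Fin θ → Fin d),
      ∃ s ∈ (((symbolicPolyMatrix K₀ K).submatrix r c).det).support,
        ∀ i ∈ s.support, v i = true := by
  rw [Literature.LinearAlgebra.Matrix.le_rank_iff_exists_det_submatrix_ne_zero]
  refine exists_congr fun r => exists_congr fun c => ?_
  rw [Ne, det_submatrix_symbolicMatrix_eq_zero_iff, ← Ne, killVars_ne_zero_iff]

end GRankSupport

/-- **A GRANK gate is the monotone DNF of the minor-monomial supports**: for every GRANK gate
`g` there is a family `T` of variable sets (the supports of the monomials of the `θ`-minors of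
its generic symbolic matrix) such that `g` accepts `v` iff some `t ∈ T` is entirely switched on.
[folklore] -/
theorem IsGRankGate.eq_true_iff_exists_support {s : ℕ} {g : GateFn} (h : IsGRankGate s g) :
    ∃ T : Set (Finset (Fin g.1)), ∀ v : Fin g.1 → Bool,
      g.2 v = true ↔ ∃ t ∈ T, ∀ i ∈ t, v i = true := by
  obtain ⟨F, _, d, θ, -, K₀, K, hg⟩ := h
  refine ⟨{t | ∃ (r c : Fin θ → Fin d),
    ∃ m ∈ (((symbolicPolyMatrix K₀ K).submatrix r c).det).support, m.support = t}, fun v => ?_⟩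
  rw [hg v, le_rank_symbolicMatrix_iff]
  constructor
  · rintro ⟨r, c, m, hm, hv⟩
    exact ⟨m.support, ⟨r, c, m, hm, rfl⟩, hv⟩
  · rintro ⟨t, ⟨r, c, m, hm, rfl⟩, hv⟩
    exact ⟨r, c, m, hm, hv⟩

end Literature.Computability.Complexity
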